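import Mathlib
import HarnessLib

/-!
# Lemmas for the far-side channel claim, II: comparing the three data energies

Analysis/PDE support file (everything proved; real analysis only). With `h, g` the data,
`L₁, L₂` the exact comparison data (ladders of Taylor polynomials), `V₀` the exact and `P` the
true potential (`P ≤ (1+ε)V₀`, `V₀ ≤ (1+ε)P` on `z ≥ 1`), and `(k₀, k_t)` the data of a true
kernel combination whose closeness integrand to `(L₁, L₂)` has integral `≤ J`:
`far_claim_compare` bounds the `P`-energy of `(h − k₀, g − k_t)` on `(1,∞)` by
`2(1+ε) S/c + 2J` when `c ∫_1^X [(h−L₁)'² + V₀(h−L₁)² + (g−L₂)²] ≤ S` for all `X`, and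
`far_claim_coeff` bounds the exact energy of `(L₁, L₂)` on `(1,2)` by `2(1+ε)E_d + 2S/c`. Route
PhotonSphereChannels, `FixedModeChannels`, far side (stmt-FinalStateConjecture-10048). Folklore.
-/

noncomputable section

namespace Literature.Analysis.PDE

open MeasureTheory Set Filter Topology intervalIntegral Real

/-- A nonnegative continuous function with bounded integrals on `[1, X]` is integrable on `(1,∞)`
with integral at most the bound. [folklore] -/
theorem integrableOn_Ioi_of_intervalIntegral_le {f : ℝ → ℝ} (hf : Continuous f)
    (hf0 : ∀ x, 1 ≤ x → 0 ≤ f x) {M : ℝ} (hM : ∀ X, 1 ≤ X → (∫ x in (1:ℝ)..X, f x) ≤ M) :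
    IntegrableOn f (Ioi 1) ∧ (∫ x in Ioi 1, f x) ≤ M := by
  have hint : IntegrableOn f (Ioi 1) := by
    refine integrableOn_Ioi_of_intervalIntegral_norm_bounded (μ := volume) (l := atTop)
      (b := fun Y : ℝ => Y) M 1 (fun Y => (hf.integrableOn_Icc).mono_set Ioc_subset_Icc_self)
      tendsto_id ?_
    filter_upwards [eventually_ge_atTop (1:ℝ)] with Y hY
    calc (∫ x in (1:ℝ)..Y, ‖f x‖) = ∫ x in (1:ℝ)..Y, f x := by
          refine intervalIntegral.integral_congr fun x hx => ?_
          rw [uIcc_of_le hY] at hx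
          simp only [Real.norm_eq_abs, abs_of_nonneg (hf0 x hx.1)]
      _ ≤ M := hM Y hY
  refine ⟨hint, le_of_tendsto (intervalIntegral_tendsto_integral_Ioi 1 hint tendsto_id) ?_⟩
  filter_upwards [eventually_ge_atTop (1:ℝ)] with Y hY
  exact hM Y hY

/-- **Comparing the data energies.** See the module docstring. [folklore] -/
theorem far_claim_compare {P V₀ h g L₁ L₂ k₀ kz kt : ℝ → ℝ} {ε c S J : ℝ}
    (hPc : Continuous P) (hP0 : ∀ z, 0 ≤ P z) (hV₀c : Continuous V₀) (hV₀0 : ∀ z, 0 ≤ V₀ z)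
    (hε : 0 ≤ ε) (hc : 0 < c) (hPV : ∀ z, 1 ≤ z → P z ≤ (1 + ε) * V₀ z)
    (hh : ContDiff ℝ 1 h) (hg : Continuous g) (hL₁ : ContDiff ℝ 1 L₁) (hL₂ : Continuous L₂)
    (hk₀ : Continuous k₀) (hkz : Continuous kz) (hkt : Continuous kt)
    (hS : ∀ X, 1 ≤ X → c * ∫ x in (1:ℝ)..X, (deriv (fun y => h y - L₁ y) x ^ 2
      + V₀ x * (h x - L₁ x) ^ 2 + (g x - L₂ x) ^ 2) ≤ S)
    (hJI : IntegrableOn (fun z => (kz z - deriv L₁ z) ^ 2 + P z * (k₀ z - L₁ z) ^ 2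
      + (kt z - L₂ z) ^ 2) (Ioi 1))
    (hJ : (∫ z in Ioi 1, ((kz z - deriv L₁ z) ^ 2 + P z * (k₀ z - L₁ z) ^ 2
      + (kt z - L₂ z) ^ 2)) ≤ J) :
    IntegrableOn (fun z => (g z - kt z) ^ 2 + (deriv h z - kz z) ^ 2 + P z * (h z - k₀ z) ^ 2)
      (Ioi 1) ∧
    (∫ z in Ioi 1, ((g z - kt z) ^ 2 + (deriv h z - kz z) ^ 2 + P z * (h z - k₀ z) ^ 2))
      ≤ 2 * ((1 + ε) * S / c) + 2 * J := by
  have hS0 : 0 ≤ S := by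
    have h := hS 1 le_rfl
    rw [intervalIntegral.integral_same, mul_zero] at h
    exact h
  have hdh : ∀ x, deriv (fun y => h y - L₁ y) x = deriv h x - deriv L₁ x := fun x =>
    deriv_fun_sub ((hh.differentiable one_ne_zero) x) ((hL₁.differentiable one_ne_zero) x)
  -- the `P`-energy of `(h − L₁, g − L₂)` on `(1,∞)`
  set IP : ℝ → ℝ := fun x => (deriv h x - deriv L₁ x) ^ 2 + P x * (h x - L₁ x) ^ 2
    + (g x - L₂ x) ^ 2 with hIP
  have hIPc : Continuous IP :=
    ((((hh.continuous_deriv le_rfl).sub (hL₁.continuous_deriv le_rfl)).pow 2).add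
      (hPc.mul ((hh.continuous.sub hL₁.continuous).pow 2))).add ((hg.sub hL₂).pow 2)
  have hIP0 : ∀ x, 0 ≤ IP x := fun x => by simp only [hIP]; have := hP0 x; positivity
  have hIPb : ∀ X, 1 ≤ X → (∫ x in (1:ℝ)..X, IP x) ≤ (1 + ε) * S / c := by
    intro X hX
    have hV := hS X hX
    have hcV : Continuous fun x => deriv (fun y => h y - L₁ y) x ^ 2
        + V₀ x * (h x - L₁ x) ^ 2 + (g x - L₂ x) ^ 2 := by
      simp_rw [hdh]
      exact ((((hh.continuous_deriv le_rfl).sub (hL₁.continuous_deriv le_rfl)).pow 2).add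
        (hV₀c.mul ((hh.continuous.sub hL₁.continuous).pow 2))).add ((hg.sub hL₂).pow 2)
    have h1 : (∫ x in (1:ℝ)..X, IP x) ≤ ∫ x in (1:ℝ)..X, (1 + ε)
        * (deriv (fun y => h y - L₁ y) x ^ 2 + V₀ x * (h x - L₁ x) ^ 2 + (g x - L₂ x) ^ 2) := by
      refine intervalIntegral.integral_mono_on hX (hIPc.intervalIntegrable _ _)
        ((hcV.intervalIntegrable _ _).const_mul _) fun x hx => ?_
      rw [hdh]
      simp only [hIP]
      have hPx := hPV x hx.1
      have hV0 := hV₀0 x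
      nlinarith [sq_nonneg (deriv h x - deriv L₁ x), sq_nonneg (g x - L₂ x), sq_nonneg (h x - L₁ x),
        mul_le_mul_of_nonneg_right hPx (sq_nonneg (h x - L₁ x)),
        mul_nonneg hε (sq_nonneg (deriv h x - deriv L₁ x)), mul_nonneg hε (sq_nonneg (g x - L₂ x)),
        mul_nonneg (mul_nonneg hε hV0) (sq_nonneg (h x - L₁ x))]
    rw [intervalIntegral.integral_const_mul] at h1
    have h2 : (∫ x in (1:ℝ)..X, (deriv (fun y => h y - L₁ y) x ^ 2 + V₀ x * (h x - L₁ x) ^ 2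
        + (g x - L₂ x) ^ 2)) ≤ S / c := by
      rw [le_div_iff₀ hc]; linarith
    calc (∫ x in (1:ℝ)..X, IP x) ≤ (1 + ε) * ∫ x in (1:ℝ)..X, (deriv (fun y => h y - L₁ y) x ^ 2
          + V₀ x * (h x - L₁ x) ^ 2 + (g x - L₂ x) ^ 2) := h1
      _ ≤ (1 + ε) * (S / c) := mul_le_mul_of_nonneg_left h2 (by linarith)
      _ = (1 + ε) * S / c := by ring
  obtain ⟨hIPi, hIPle⟩ := integrableOn_Ioi_of_intervalIntegral_le hIPc (fun x _ => hIP0 x) hIPb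
  -- pointwise splitting
  set E : ℝ → ℝ := fun z => (g z - kt z) ^ 2 + (deriv h z - kz z) ^ 2 + P z * (h z - k₀ z) ^ 2
    with hE
  set Jf : ℝ → ℝ := fun z => (kz z - deriv L₁ z) ^ 2 + P z * (k₀ z - L₁ z) ^ 2
    + (kt z - L₂ z) ^ 2 with hJf
  have hEc : Continuous E :=
    (((hg.sub hkt).pow 2).add (((hh.continuous_deriv le_rfl).sub hkz).pow 2)).add
      (hPc.mul ((hh.continuous.sub hk₀).pow 2))
  have hE0 : ∀ z, 0 ≤ E z := fun z => by simp only [hE]; have := hP0 z; positivity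
  have hpt : ∀ z, E z ≤ 2 * IP z + 2 * Jf z := by
    intro z
    simp only [hE, hIP, hJf]
    have hPz := hP0 z
    nlinarith [sq_nonneg ((g z - L₂ z) + (kt z - L₂ z)), sq_nonneg ((deriv h z - deriv L₁ z)
      + (kz z - deriv L₁ z)), mul_nonneg hPz (sq_nonneg ((h z - L₁ z) + (k₀ z - L₁ z)))]
  have hEi : IntegrableOn E (Ioi 1) :=
    Integrable.mono' ((hIPi.const_mul 2).add (hJI.const_mul 2)) hEc.aestronglyMeasurable
      ((ae_restrict_iff' measurableSet_Ioi).2 (ae_of_all _ fun z _ => by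
        rw [Real.norm_eq_abs, abs_of_nonneg (hE0 z)]; exact hpt z))
  refine ⟨hEi, ?_⟩
  calc (∫ z in Ioi 1, E z) ≤ ∫ z in Ioi 1, (2 * IP z + 2 * Jf z) :=
        setIntegral_mono_on hEi ((hIPi.const_mul 2).add (hJI.const_mul 2)) measurableSet_Ioi
          fun z _ => hpt z
    _ = 2 * (∫ z in Ioi 1, IP z) + 2 * ∫ z in Ioi 1, Jf z := by
        rw [integral_add (hIPi.const_mul 2) (hJI.const_mul 2), MeasureTheory.integral_const_mul,
          MeasureTheory.integral_const_mul]
    _ ≤ 2 * ((1 + ε) * S / c) + 2 * J := by linarith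

/-- **The exact energy of the comparison data on `(1,2)`.** [folklore] -/
theorem far_claim_coeff {P V₀ h g L₁ L₂ : ℝ → ℝ} {ε c S Ed : ℝ}
    (hP0 : ∀ z, 0 ≤ P z) (hV₀c : Continuous V₀) (hV₀0 : ∀ z, 0 ≤ V₀ z)
    (hε : 0 ≤ ε) (hc : 0 < c) (hVP : ∀ z, 1 ≤ z → V₀ z ≤ (1 + ε) * P z)
    (hh : ContDiff ℝ 1 h) (hg : Continuous g) (hL₁ : ContDiff ℝ 1 L₁) (hL₂ : Continuous L₂)
    (hS : c * ∫ x in (1:ℝ)..2, (deriv (fun y => h y - L₁ y) x ^ 2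
      + V₀ x * (h x - L₁ x) ^ 2 + (g x - L₂ x) ^ 2) ≤ S)
    (hEdI : IntegrableOn (fun z => g z ^ 2 + deriv h z ^ 2 + P z * h z ^ 2) (Ioi 1))
    (hEd : (∫ z in Ioi 1, (g z ^ 2 + deriv h z ^ 2 + P z * h z ^ 2)) ≤ Ed) :
    (∫ x in (1:ℝ)..2, (deriv L₁ x ^ 2 + V₀ x * L₁ x ^ 2 + L₂ x ^ 2))
      ≤ 2 * ((1 + ε) * Ed) + 2 * (S / c) := by
  have hdh : ∀ x, deriv (fun y => h y - L₁ y) x = deriv h x - deriv L₁ x := fun x =>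
    deriv_fun_sub ((hh.differentiable one_ne_zero) x) ((hL₁.differentiable one_ne_zero) x)
  have hT : (∫ x in (1:ℝ)..2, (deriv (fun y => h y - L₁ y) x ^ 2 + V₀ x * (h x - L₁ x) ^ 2
      + (g x - L₂ x) ^ 2)) ≤ S / c := by rw [le_div_iff₀ hc]; linarith
  -- the exact energy of the data on `(1,2)` is at most `(1+ε) E_d`
  have hcd : Continuous fun x => g x ^ 2 + deriv h x ^ 2 + V₀ x * h x ^ 2 :=
    ((hg.pow 2).add ((hh.continuous_deriv le_rfl).pow 2)).add (hV₀c.mul (hh.continuous.pow 2))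
  have hPi : IntervalIntegrable (fun x => g x ^ 2 + deriv h x ^ 2 + P x * h x ^ 2) volume 1 2 :=
    (intervalIntegrable_iff_integrableOn_Ioc_of_le (by norm_num)).2
      (hEdI.mono_set Ioc_subset_Ioi_self)
  have hD : (∫ x in (1:ℝ)..2, (g x ^ 2 + deriv h x ^ 2 + V₀ x * h x ^ 2)) ≤ (1 + ε) * Ed := by
    have h1 : (∫ x in (1:ℝ)..2, (g x ^ 2 + deriv h x ^ 2 + V₀ x * h x ^ 2))
        ≤ ∫ x in (1:ℝ)..2, (1 + ε) * (g x ^ 2 + deriv h x ^ 2 + P x * h x ^ 2) := by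
      refine intervalIntegral.integral_mono_on (by norm_num) (hcd.intervalIntegrable _ _)
        (hPi.const_mul _) fun x hx => ?_
      have hV := hVP x hx.1
      have hPx := hP0 x
      nlinarith [sq_nonneg (g x), sq_nonneg (deriv h x), mul_le_mul_of_nonneg_right hV
        (sq_nonneg (h x)), mul_nonneg hε (sq_nonneg (g x)), mul_nonneg hε (sq_nonneg (deriv h x))]
    have h2 : (∫ x in (1:ℝ)..2, (g x ^ 2 + deriv h x ^ 2 + P x * h x ^ 2)) ≤ Ed := by
      rw [intervalIntegral.integral_of_le (by norm_num)]
      exact (setIntegral_mono_set hEdI (ae_of_all _ fun x => by have := hP0 x; positivity)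
        (ae_of_all _ Ioc_subset_Ioi_self)).trans hEd
    rw [intervalIntegral.integral_const_mul] at h1
    exact h1.trans (mul_le_mul_of_nonneg_left h2 (by linarith))
  -- pointwise splitting on `[1,2]`
  have hc1 : Continuous fun x => deriv L₁ x ^ 2 + V₀ x * L₁ x ^ 2 + L₂ x ^ 2 :=
    (((hL₁.continuous_deriv le_rfl).pow 2).add (hV₀c.mul (hL₁.continuous.pow 2))).add (hL₂.pow 2)
  have hc2 : Continuous fun x => deriv (fun y => h y - L₁ y) x ^ 2 + V₀ x * (h x - L₁ x) ^ 2
      + (g x - L₂ x) ^ 2 := by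
    simp_rw [hdh]
    exact ((((hh.continuous_deriv le_rfl).sub (hL₁.continuous_deriv le_rfl)).pow 2).add
      (hV₀c.mul ((hh.continuous.sub hL₁.continuous).pow 2))).add ((hg.sub hL₂).pow 2)
  calc (∫ x in (1:ℝ)..2, (deriv L₁ x ^ 2 + V₀ x * L₁ x ^ 2 + L₂ x ^ 2))
      ≤ ∫ x in (1:ℝ)..2, (2 * (g x ^ 2 + deriv h x ^ 2 + V₀ x * h x ^ 2)
          + 2 * (deriv (fun y => h y - L₁ y) x ^ 2 + V₀ x * (h x - L₁ x) ^ 2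
            + (g x - L₂ x) ^ 2)) := by
        refine intervalIntegral.integral_mono_on (by norm_num) (hc1.intervalIntegrable _ _)
          (((hcd.intervalIntegrable _ _).const_mul _).add ((hc2.intervalIntegrable _ _).const_mul _))
          fun x _ => ?_
        rw [hdh]
        have hV0 := hV₀0 x
        nlinarith [sq_nonneg (2 * deriv h x - deriv L₁ x), sq_nonneg (2 * g x - L₂ x),
          mul_nonneg hV0 (sq_nonneg (2 * h x - L₁ x))]
    _ = 2 * (∫ x in (1:ℝ)..2, (g x ^ 2 + deriv h x ^ 2 + V₀ x * h x ^ 2))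
        + 2 * ∫ x in (1:ℝ)..2, (deriv (fun y => h y - L₁ y) x ^ 2 + V₀ x * (h x - L₁ x) ^ 2
            + (g x - L₂ x) ^ 2) := by
        rw [intervalIntegral.integral_add ((hcd.intervalIntegrable _ _).const_mul _)
          ((hc2.intervalIntegrable _ _).const_mul _), intervalIntegral.integral_const_mul,
          intervalIntegral.integral_const_mul]
    _ ≤ 2 * ((1 + ε) * Ed) + 2 * (S / c) := by linarith

/-- The final arithmetic of the far-side channel claim. [folklore] -/
theorem far_claim_arith {X S L Ed ε c Kc CK δ δ₁ : ℝ} (hc : 0 < c) (hKc : 0 ≤ Kc) (hCK : 0 ≤ CK)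
    (hε : 0 ≤ ε) (hε1 : ε ≤ 1) (hEd : 0 ≤ Ed) (hS0 : 0 ≤ S)
    (hE : X ≤ 2 * ((1 + ε) * S / c) + 2 * (Kc * ε ^ 2 * (CK * (2 * ((1 + ε) * Ed) + 2 * (S / c)))))
    (hSb : S ≤ 4 * L + 64 * ε ^ 2 * Ed + δ₁)
    (hδ : (4 / c + 4 * Kc * CK / c) * δ₁ ≤ δ) :
    X ≤ (16 / c + 16 * Kc * CK / c) * L + (256 / c + 8 * Kc * CK + 256 * Kc * CK / c) * ε ^ 2 * Ed
      + δ := by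
  have hε2 : ε ^ 2 ≤ 1 := by nlinarith
  have hc4 : (0:ℝ) ≤ 4 / c := by positivity
  have hK4 : (0:ℝ) ≤ 4 * Kc * CK / c := by positivity
  have t1 : 2 * ((1 + ε) * S / c) ≤ (4 / c) * S := by
    rw [show 2 * ((1 + ε) * S / c) = (2 * (1 + ε)) * (S / c) by ring,
      show (4 / c) * S = 4 * (S / c) by ring]
    exact mul_le_mul_of_nonneg_right (by linarith) (div_nonneg hS0 hc.le)
  have t2 : 2 * (Kc * ε ^ 2 * (CK * (2 * ((1 + ε) * Ed) + 2 * (S / c))))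
      ≤ 8 * Kc * CK * ε ^ 2 * Ed + (4 * Kc * CK / c) * ε ^ 2 * S := by
    have h2 : 0 ≤ Kc * ε ^ 2 * CK := by positivity
    calc 2 * (Kc * ε ^ 2 * (CK * (2 * ((1 + ε) * Ed) + 2 * (S / c))))
        = 2 * (Kc * ε ^ 2 * CK) * (2 * ((1 + ε) * Ed) + 2 * (S / c)) := by ring
      _ ≤ 2 * (Kc * ε ^ 2 * CK) * (4 * Ed + 2 * (S / c)) := by
          refine mul_le_mul_of_nonneg_left (by nlinarith) (by positivity)
      _ = 8 * Kc * CK * ε ^ 2 * Ed + (4 * Kc * CK / c) * ε ^ 2 * S := by ring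
  have t3 : (4 / c) * S ≤ (16 / c) * L + (256 / c) * ε ^ 2 * Ed + (4 / c) * δ₁ := by
    have := mul_le_mul_of_nonneg_left hSb hc4
    have e : (4 / c) * (4 * L + 64 * ε ^ 2 * Ed + δ₁)
        = (16 / c) * L + (256 / c) * ε ^ 2 * Ed + (4 / c) * δ₁ := by ring
    linarith
  have t4 : (4 * Kc * CK / c) * ε ^ 2 * S
      ≤ (16 * Kc * CK / c) * L + (256 * Kc * CK / c) * ε ^ 2 * Ed + (4 * Kc * CK / c) * δ₁ := by
    have h1 : (4 * Kc * CK / c) * ε ^ 2 * S ≤ (4 * Kc * CK / c) * S := by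
      have := mul_le_mul_of_nonneg_left (mul_le_of_le_one_left hS0 hε2) hK4
      linarith
    have h2 := mul_le_mul_of_nonneg_left hSb hK4
    have h3 : (4 * Kc * CK / c) * (64 * ε ^ 2 * Ed) ≤ (256 * Kc * CK / c) * ε ^ 2 * Ed := by
      have : (4 * Kc * CK / c) * (64 * ε ^ 2 * Ed) = (256 * Kc * CK / c) * ε ^ 2 * Ed := by ring
      linarith
    have e : (4 * Kc * CK / c) * (4 * L + 64 * ε ^ 2 * Ed + δ₁)
        = (16 * Kc * CK / c) * L + (4 * Kc * CK / c) * (64 * ε ^ 2 * Ed)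
          + (4 * Kc * CK / c) * δ₁ := by ring
    linarith
  have e5 : (4 / c + 4 * Kc * CK / c) * δ₁ = (4 / c) * δ₁ + (4 * Kc * CK / c) * δ₁ := by ring
  linarith

end Literature.Analysis.PDE
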